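import Literature.MathematicalPhysics.QuantumFieldTheory.Balaban1983to89.B5Eq135Momentum
import HarnessLib

/-!
# Route `UnitScaleTilt`, crux K1 «MinimiserStabilityRegPr» (stmt-QuantumFields-19200), route-R ∕ E′ closure (U2), SLICE row — LEMMA (S_blk-DIV) FLAT:
# ON PRINT'S (1.38) SLICE THE DIVERGENCE IS `O(ℓ⁻¹)` IN `H^{-1}`-CURRENCY —
# `‖P∂*A‖² ≤ C_d · Σ_p |(P∂*A)~(p)|² ∕ Δ(p)`, `C_d = dπ² + (π²∕4)^d·(dπ²)³∕16` (absolute), for the block-Landau projection `P` of [Balaban1984PropagatorsI] (1.26)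

Cell `ym3-torus`, D-0154 (3c) twin-width seat `ym-routeR-w3` (gen 5); row named by ★p1 g14 (CARD-19200-V3-g14 §3, 2026-08-28 16:05Z) and ★★OWNER RULING g27-№8 (2).
THEOREMS ONLY (0 `def`, 0 `sorry`); `--supports stmt-QuantumFields-19200`, count-neutral.  YM₃ on T³ is a ladder rung (R3), not the Clay problem; nothing here claims the
stub, the crux, d = 4 or the mass gap.

THE POINT.  The E′ text of record ✓ `…Prop7LocMinOfGaugedRows116Text.stub_PV3E_of_fibreRows` displays per competitor a SLICE row `DIV ≤ ζK + δ₀ℓ⁻²M` for the chart direction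
on print's slice (1.38) «`R(U₀)D^*_{U₀}A = 0`» = «`Δ(D^*A) ∈ range Q′ᵀ`» (✓ `B8Eq138LandauZd.IsLandau138`, multiplier form).  At the FLAT background this is a statement of
discrete Fourier analysis on the torus, and the tree already holds every letter of it: [Balaban1984PropagatorsI] Sect. C typed on the torus `T_η = Tor (fine n M)` (block
side `n = L^k`, `M_μ` blocks per direction) — the block average `Q′_k = B5Block118.QsOp`, the Laplacian `Δ = B5Action121.LapS` (lattice constant `c = n`, i.e. `η = n⁻¹`),
the PROJECTION `P = B5Value126.PcT = Δ⁻¹Q′*(Q′Δ⁻²Q′*)⁻¹Q′Δ⁻¹` of (1.26)∕(1.70) — whose range IS the slice `{b ⊥ 1 : Δb ∈ range Q′*}` —, its momentum representation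
✓ `B5Momentum133.dft_PcT_apply_of_ne` and the momentum form (1.35) of `‖P∂*A‖²` ✓ `B5Eq135Momentum.eq135`, with the alias decomposition `p = p′ + l` (✓ `pOf`,
✓ `sum_pOf_fibres`) and the leaves `Σ_l|u(p′+l)|² = 1` (✓ `B5Prop11Leaves.sum_Ur_eq_one`), `Δ(p′+l) ≥ 4` for `l ≠ 0` (✓ `DeltaXir_shift_ge_four`), `|u(p′)|² ≥ (4∕π²)^d`
(✓ `B4Strip.Ur_zero_ge`), `Δ(p′) ≤ dπ²` (✓ `Sxir_le`).  On the fibre `p′ ≠ 0` the projection is rank one along `l ↦ ū(p′+l)∕Δ(p′+l)`, so the claim reduces to the scalar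
ALIAS INEQUALITY `Σ_l |u|²∕Δ² ≤ C_d·Σ_l |u|²∕Δ³`, which the four leaves give with `C_d = dπ² + (π²∕4)^d(dπ²)³∕16` (`l = 0`: `Δ(p′) ≤ dπ²`; `l ≠ 0`: `Σ ≤ 1∕16 ≤ (1∕16)(π²∕4)^d(dπ²)³·
|u(p′)|²∕Δ(p′)³`).  In η-units (`c = n`) the bound reads `‖P b‖² ≤ C_d·⟨Pb, Δ_η⁻¹ Pb⟩`; since `Δ_η = n²·Δ_lattice`, in lattice units it is `‖P b‖² ≤ C_d·n⁻²·⟨Pb, Δ⁻¹Pb⟩` —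
the `ℓ⁻²` of the SLICE row (`ℓ = n`), and `⟨∂^*A, Δ⁻¹∂^*A⟩ ≤ ‖A‖²` turns it into `DIV ≤ C_d ℓ⁻² M` for `∂^*A` on the slice (the dictionary to the torus letters of the E′ door is
the next file).

WHAT IS PROVED (ns `…Theorems.Prop7BlockLandauDivFlat`; any `d`, block side `n ≥ 1`, any block counts `M_μ ≥ 1`).
* §1 `alias_sum_sq_le` — the scalar alias inequality `Σ_k Ur∕D_k² ≤ C_d·Σ_k Ur∕D_k³` at every reduced momentum `s ≠ 0`, `|s_μ| ≤ π` (`D_k = Δ(p′+l)`, `Ur = |u(p′+l)|²`).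
* §2 `norm_Xs_le` — the printed normalising sum `X(p′) = Σ_l|u|²∕Δ²` (✓ `Xs`) is `≤ C_d·Σ_l|u|²∕Δ³` for `p′ ≠ 0`.
* §3 ★★★ `sum_norm_sq_PcT_le` — for every `b ⊥ 1` on `T_η`: `Σ_x|(Pb)(x)|² ≤ C_d·Σ_p |(Pb)~(p)|²∕Δ(p)` (unitary DFT ✓ `dft`; `Δ(p) = lsym (fine n M) n p`; the fibre `p′ = 0` carries
  nothing, ✓ `dft_PcT_zero_fiber`).
* §4 position space: `sum_norm_sq_div_lsym_eq` (`Σ_p|f̃|²∕Δ(p) = re⟨f, Δ⁻¹f⟩`, ✓ `LapSinv`), `PcT_mulVec_eq_self_of_slice` (THE SLICE IS THE RANGE OF `P`: `b ⊥ 1`, `Δb = Q′*μ` ⇒ `Pb = b`;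
  ✓ `Minv_Mop_of_orth`, ✓ `LapSinv_const`, ✓ `QsOp_adjoint_mulVec`), `re_dot_divS_LapSinv_le` (`re⟨∂^*A, Δ⁻¹∂^*A⟩ ≤ ‖A‖²`: `∂Δ⁻¹∂^*` is an orthogonal projection, ✓ `form_of_projection`),
  and ★★★ `sum_norm_sq_divS_le_of_slice` — THE DIVERGENCE FORM: `Δ(∂^*A) = Q′*μ ⇒ Σ_x|∂^*A(x)|² ≤ C_d·Σ_{x,μ}|A(x,μ)|²` with `∂^* = divS … n` (the `η⁻¹ = n` of (1.1) inside, so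
  `‖div_lattice A‖² ≤ C_d·n⁻²·‖A‖²`: the SLICE row `DIV ≤ δ₀ℓ⁻²M` at the flat background, `δ₀ = C_d`, `ζ = 0`, `ℓ = n`).
HONEST SCOPE.  Flat background only (print's `U₀ = 1` model, one `k`-fold block averaging of side `n = L^k` read as ONE averaging `Q′_k` — [Balaban1984PropagatorsI]'s own
setting (1.18)–(1.20)); the curved `+O(ε)` and the dictionary from `IsLandauPrint` (based `ℤᵈ` pullbacks, ✓ `B8Eq138LandauZd`) ∕ to `divB (torusT …)` of the E′ door are NOT here.
Constants ours; nothing of [Balaban1984PropagatorsI] beyond the cited tree theorems is asserted.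

References: T. Bałaban, CMP 95 (1984) 17–40 [Balaban1984PropagatorsI] ((1.26) p.22, (1.31)–(1.36) pp.23–24, (1.69)–(1.70) pp.29–30); CMP 99 (1985) 75–102
[Balaban1985RegularSpaces] ((1.27) p.80, (1.38) p.82); CMP 99 (1985) 389–434 [Balaban1985BackgroundPropagators] ((3.25) p.394); CMP 102 (1985) 277–309
[Balaban1985Variational] ((21) p.281, Prop. 7 p.299).
-/

set_option autoImplicit false

noncomputable section

open scoped BigOperators Matrix ComplexConjugate ComplexOrder
open Finset Complex Matrix

namespace Summit.QuantumFields.YangMills.Theorems.Prop7BlockLandauDivFlat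

open Literature.MathematicalPhysics.QuantumFieldTheory.Balaban1983to89
open B4Strip B5Prop11Fiber B5Prop11Leaves B5Prop11Plancherel B5Action121 B5Block118 B5LaplaceInverse B5LaplaceSpectral B5Value126
open B5Momentum130 B5Momentum133 B5Eq135Momentum B5Substitution125 B5Adjoint130 B5Projection127 B5DivOrth

variable {d : ℕ} (n : ℕ) [NeZero n] (M : Fin d → ℕ) [hM : ∀ μ, NeZero (M μ)]

/-! ## §1 The scalar alias inequality at one reduced momentum -/

/-- **THE ALIAS INEQUALITY** at a reduced momentum `p′ = s ≠ 0`, `|s_μ| ≤ π`: with `Ur = |u(p′+l)|²` (✓ `B4Strip.Ur`) and `D_l = Δ(p′+l)` (✓ `DeltaXir n 0 (shiftr n l s)`, η-units),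
`Σ_l Ur_l∕D_l² ≤ (dπ² + (π²∕4)^d·(dπ²)³∕16)·Σ_l Ur_l∕D_l³` — from `Σ_l Ur_l = 1`, `D_l ≥ 4` (`l ≠ 0`), `Ur_0 ≥ (4∕π²)^d`, `0 < D_0 ≤ dπ²`.
[cite: Balaban1984PropagatorsI, (1.31)-(1.36) pp.23-24] -/
theorem alias_sum_sq_le (hn : 1 ≤ n) (s : Fin d → ℝ) (hs : ∀ μ, |s μ| ≤ Real.pi) (hs0 : s ≠ 0) :
    ∑ k : Fin d → Fin n, Ur n k s / DeltaXir n 0 (shiftr n k s) ^ 2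
      ≤ (d * Real.pi ^ 2 + (Real.pi ^ 2 / 4) ^ d * (d * Real.pi ^ 2) ^ 3 / 16)
          * ∑ k : Fin d → Fin n, Ur n k s / DeltaXir n 0 (shiftr n k s) ^ 3 := by
  -- letters at `l = 0`
  set k0 : Fin d → Fin n := fun _ => (0 : Fin n) with hk0
  obtain ⟨μ0, hμ0⟩ : ∃ μ, s μ ≠ 0 := Function.ne_iff.mp hs0
  have hpi : 0 < Real.pi := Real.pi_pos
  have hD0 : DeltaXir n 0 (shiftr n k0 s) = DeltaXir n 0 s := by rw [hk0, shiftr_zero]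
  have hD0pos : 0 < DeltaXir n 0 s := DeltaXir_pos n hn s hs μ0 hμ0
  have hD0le : DeltaXir n 0 s ≤ d * Real.pi ^ 2 := by
    unfold DeltaXir
    rw [add_zero]
    calc ∑ μ, Sxir n (s μ) ≤ ∑ _μ : Fin d, Real.pi ^ 2 := Finset.sum_le_sum fun μ _ =>
            (Sxir_le n (s μ)).trans (by have := hs μ; nlinarith [abs_le.mp this, sq_abs (s μ)])
      _ = d * Real.pi ^ 2 := by rw [Finset.sum_const, Finset.card_univ, Fintype.card_fin, nsmul_eq_mul]
  have hU0 : (4 / Real.pi ^ 2) ^ d ≤ Ur n k0 s := Ur_zero_ge n hn s hs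
  have hUnn : ∀ k, 0 ≤ Ur n k s := fun k => Ur_nonneg n k s
  have hDnn : ∀ k, 0 ≤ DeltaXir n 0 (shiftr n k s) := fun k => DeltaXir_nonneg n 0 le_rfl _
  have hDk : ∀ k, k ≠ k0 → 4 ≤ DeltaXir n 0 (shiftr n k s) := fun k hk => DeltaXir_shift_ge_four n k hk s hs
  have hS0 : ∑ k ∈ univ.erase k0, Ur n k s ≤ 1 := S0_le_one n hn s hs
  -- the `l = 0` term of the right-hand side controls everything
  set T : ℝ := Ur n k0 s / DeltaXir n 0 s ^ 3 with hT
  have hTpos : 0 < T := by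
    have h4 : 0 < (4 / Real.pi ^ 2) ^ d := by positivity
    exact div_pos (h4.trans_le hU0) (pow_pos hD0pos 3)
  -- (i) the `l = 0` term of the left-hand side
  have h0 : Ur n k0 s / DeltaXir n 0 (shiftr n k0 s) ^ 2 ≤ d * Real.pi ^ 2 * T := by
    rw [hD0, hT]
    have e : Ur n k0 s / DeltaXir n 0 s ^ 2 = DeltaXir n 0 s * (Ur n k0 s / DeltaXir n 0 s ^ 3) := by
      field_simp
    rw [e]
    exact mul_le_mul_of_nonneg_right hD0le (div_nonneg (hUnn _) (pow_nonneg hD0pos.le 3))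
  -- (ii) the aliases `l ≠ 0`
  have h1 : ∑ k ∈ univ.erase k0, Ur n k s / DeltaXir n 0 (shiftr n k s) ^ 2 ≤ 1 / 16 := by
    calc ∑ k ∈ univ.erase k0, Ur n k s / DeltaXir n 0 (shiftr n k s) ^ 2 ≤ ∑ k ∈ univ.erase k0, Ur n k s / 16 := by
          refine Finset.sum_le_sum fun k hk => ?_
          have h4 := hDk k (Finset.ne_of_mem_erase hk)
          have h16 : (16 : ℝ) ≤ DeltaXir n 0 (shiftr n k s) ^ 2 := by nlinarith
          exact div_le_div_of_nonneg_left (hUnn k) (by norm_num) h16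
      _ = (∑ k ∈ univ.erase k0, Ur n k s) / 16 := by rw [Finset.sum_div]
      _ ≤ 1 / 16 := by gcongr
  have h1' : (1 : ℝ) / 16 ≤ (Real.pi ^ 2 / 4) ^ d * (d * Real.pi ^ 2) ^ 3 / 16 * T := by
    -- `1 ≤ (π²/4)^d (dπ²)³ · Ur_0 / D_0³` from `Ur_0 ≥ (4/π²)^d` and `D_0 ≤ dπ²`
    have hA : (1 : ℝ) ≤ (Real.pi ^ 2 / 4) ^ d * Ur n k0 s := by
      calc (1 : ℝ) = (Real.pi ^ 2 / 4) ^ d * (4 / Real.pi ^ 2) ^ d := by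
            rw [← mul_pow]; rw [show Real.pi ^ 2 / 4 * (4 / Real.pi ^ 2) = (1 : ℝ) by field_simp]; simp
        _ ≤ (Real.pi ^ 2 / 4) ^ d * Ur n k0 s := mul_le_mul_of_nonneg_left hU0 (by positivity)
    have hB : DeltaXir n 0 s ^ 3 ≤ (d * Real.pi ^ 2) ^ 3 := pow_le_pow_left₀ hD0pos.le hD0le 3
    have hB' : (1 : ℝ) ≤ (d * Real.pi ^ 2) ^ 3 / DeltaXir n 0 s ^ 3 := by
      rw [le_div_iff₀ (pow_pos hD0pos 3), one_mul]; exact hB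
    have hprod : (1 : ℝ) ≤ (Real.pi ^ 2 / 4) ^ d * (d * Real.pi ^ 2) ^ 3 * T := by
      have e : (Real.pi ^ 2 / 4) ^ d * (d * Real.pi ^ 2) ^ 3 * T
          = ((Real.pi ^ 2 / 4) ^ d * Ur n k0 s) * ((d * Real.pi ^ 2) ^ 3 / DeltaXir n 0 s ^ 3) := by
        rw [hT]; ring
      rw [e]
      calc (1 : ℝ) = 1 * 1 := (mul_one 1).symm
        _ ≤ _ := mul_le_mul hA hB' zero_le_one (le_trans zero_le_one hA)
    have := mul_le_mul_of_nonneg_left hprod (show (0 : ℝ) ≤ 1 / 16 by norm_num)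
    linarith
  -- (iii) the right-hand side dominates its `l = 0` term
  have hR : T ≤ ∑ k : Fin d → Fin n, Ur n k s / DeltaXir n 0 (shiftr n k s) ^ 3 := by
    rw [hT, ← hD0]
    exact Finset.single_le_sum (f := fun k => Ur n k s / DeltaXir n 0 (shiftr n k s) ^ 3)
      (fun k _ => div_nonneg (hUnn k) (pow_nonneg (hDnn k) 3)) (Finset.mem_univ k0)
  -- assemble
  rw [← Finset.add_sum_erase _ _ (Finset.mem_univ k0)]
  have hC0 : 0 ≤ (d * Real.pi ^ 2 + (Real.pi ^ 2 / 4) ^ d * (d * Real.pi ^ 2) ^ 3 / 16 : ℝ) := by positivity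
  calc Ur n k0 s / DeltaXir n 0 (shiftr n k0 s) ^ 2 + ∑ k ∈ univ.erase k0, Ur n k s / DeltaXir n 0 (shiftr n k s) ^ 2
      ≤ d * Real.pi ^ 2 * T + (Real.pi ^ 2 / 4) ^ d * (d * Real.pi ^ 2) ^ 3 / 16 * T := add_le_add h0 (h1.trans h1')
    _ = (d * Real.pi ^ 2 + (Real.pi ^ 2 / 4) ^ d * (d * Real.pi ^ 2) ^ 3 / 16) * T := by ring
    _ ≤ (d * Real.pi ^ 2 + (Real.pi ^ 2 / 4) ^ d * (d * Real.pi ^ 2) ^ 3 / 16)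
          * ∑ k : Fin d → Fin n, Ur n k s / DeltaXir n 0 (shiftr n k s) ^ 3 := mul_le_mul_of_nonneg_left hR hC0

/-! ## §2 The printed normalising sum `X(p′) = Σ_l |u|²∕Δ²` against `Σ_l |u|²∕Δ³` -/

/-- **`X(p′) ≤ C_d·Σ_l |u(p′+l)|²∕Δ(p′+l)³`** for `p′ ≠ 0` (`X = B5Momentum133.Xs`, the printed normalising sum of (1.33); `Δ(p′+l) = lsym (fine n M) n (pOf (l, p′))`,
η-units `c = n`). [cite: Balaban1984PropagatorsI, (1.33) p.23, (1.35) p.24] -/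
theorem norm_Xs_le (hn : 1 ≤ n) {q : Tor M} (hq : q ≠ 0) :
    ‖Xs n M (n : ℂ) q‖ ≤ (d * Real.pi ^ 2 + (Real.pi ^ 2 / 4) ^ d * (d * Real.pi ^ 2) ^ 3 / 16)
        * ∑ k : Fin d → Fin n, ‖uSym n k (sOf M q)‖ ^ 2 / ‖lsym (fine n M) (n : ℂ) (pOf n M (k, q))‖ ^ 3 := by
  have hs : ∀ μ, |sOf M q μ| ≤ Real.pi := abs_sOf_le M q
  have hs0 : sOf M q ≠ 0 := sOf_ne_zero M hq
  have hnorm : ∀ k : Fin d → Fin n, ‖lsym (fine n M) (n : ℂ) (pOf n M (k, q))‖ = DeltaXir n 0 (shiftr n k (sOf M q)) := fun k => by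
    rw [lsym_pOf, Complex.norm_real, Real.norm_of_nonneg (DeltaXir_nonneg n 0 le_rfl _)]
  rw [norm_Xs]
  simp_rw [hnorm, norm_uSym_sq n hn _ (sOf M q) hs]
  exact alias_sum_sq_le n hn (sOf M q) hs hs0

/-! ## §3 ★★★ The flat block-Landau divergence bound -/

/-- ★★★ **LEMMA (S_blk-DIV), FLAT: ON THE RANGE OF THE BLOCK-LANDAU PROJECTION THE `L²` NORM IS CONTROLLED BY THE `H^{−1}` NORM.**  On the torus `T_η = Tor (fine n M)`
(blocks of side `n ≥ 1`, `M_μ ≥ 1` blocks per direction, lattice constant `c = n`), with `P = B5Value126.PcT` the projection `Δ⁻¹Q′*(Q′Δ⁻²Q′*)⁻¹Q′Δ⁻¹` of (1.26)∕(1.70) — whose range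
is the slice «`Δ b ∈ range Q′*`» = (1.38) «`R D^*A = 0`» at `U₀ = 1` — for every `b ⊥ 1` (`b = ∂^*A`):
`Σ_x |(Pb)(x)|² ≤ (dπ² + (π²∕4)^d(dπ²)³∕16)·Σ_p |(Pb)~(p)|²∕Δ(p)` (unitary DFT, `Δ(p) = lsym (fine n M) n p`; the fibre `p′ = 0` carries nothing).  In lattice units (`Δ = n²·Δ_lattice`) this is
`‖Pb‖² ≤ C_d·n⁻²·⟨Pb, Δ_lattice⁻¹Pb⟩` — the `ℓ⁻²` of the SLICE row. [cite: Balaban1984PropagatorsI, (1.26) p.22, (1.35) p.24; Balaban1985RegularSpaces, (1.38) p.82] -/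
theorem sum_norm_sq_PcT_le (hn : 1 ≤ n) (b : Tor (fine n M) → ℂ) (hb : ∑ x, b x = 0) :
    ∑ x, ‖(PcT n M (n : ℂ) *ᵥ b) x‖ ^ 2
      ≤ (d * Real.pi ^ 2 + (Real.pi ^ 2 / 4) ^ d * (d * Real.pi ^ 2) ^ 3 / 16)
          * ∑ p, ‖(dft (fine n M) *ᵥ (PcT n M (n : ℂ) *ᵥ b)) p‖ ^ 2 / ‖lsym (fine n M) (n : ℂ) p‖ := by
  have hc : (n : ℂ) ≠ 0 := Nat.cast_ne_zero.mpr (NeZero.ne n)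
  have hC0 : 0 ≤ (d * Real.pi ^ 2 + (Real.pi ^ 2 / 4) ^ d * (d * Real.pi ^ 2) ^ 3 / 16) := by positivity
  -- the left side in momentum form, (1.35)
  have hL : ∑ x, ‖(PcT n M (n : ℂ) *ᵥ b) x‖ ^ 2 = ∑ q ∈ univ.erase (0 : Tor M), ‖Bs n M (n : ℂ) b q‖ ^ 2 / ‖Xs n M (n : ℂ) q‖ := by
    rw [← residual_lambda0 n M (n : ℂ) hc b hb]
    exact eq135 n M (n : ℂ) hc b hb
  -- the right side fibre by fibre
  have hR : ∑ p, ‖(dft (fine n M) *ᵥ (PcT n M (n : ℂ) *ᵥ b)) p‖ ^ 2 / ‖lsym (fine n M) (n : ℂ) p‖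
      = ∑ q ∈ univ.erase (0 : Tor M), (‖Bs n M (n : ℂ) b q‖ ^ 2 / ‖Xs n M (n : ℂ) q‖ ^ 2)
          * ∑ k : Fin d → Fin n, ‖uSym n k (sOf M q)‖ ^ 2 / ‖lsym (fine n M) (n : ℂ) (pOf n M (k, q))‖ ^ 3 := by
    rw [sum_pOf_fibres n M (fun p => ‖(dft (fine n M) *ᵥ (PcT n M (n : ℂ) *ᵥ b)) p‖ ^ 2 / ‖lsym (fine n M) (n : ℂ) p‖),
      ← Finset.add_sum_erase _ _ (Finset.mem_univ (0 : Tor M))]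
    have h0 : ∑ k : Fin d → Fin n, ‖(dft (fine n M) *ᵥ (PcT n M (n : ℂ) *ᵥ b)) (pOf n M (k, 0))‖ ^ 2 / ‖lsym (fine n M) (n : ℂ) (pOf n M (k, 0))‖ = 0 :=
      Finset.sum_eq_zero fun k _ => by rw [dft_PcT_zero_fiber, norm_zero, zero_pow two_ne_zero, zero_div]
    rw [h0, zero_add]
    refine Finset.sum_congr rfl fun q hq => ?_
    rw [Finset.mul_sum]
    refine Finset.sum_congr rfl fun k _ => ?_
    rw [norm_sq_dft_PcT_of_ne n M (n : ℂ) hc b k (Finset.ne_of_mem_erase hq)]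
    ring
  rw [hL, hR, Finset.mul_sum]
  refine Finset.sum_le_sum fun q hq => ?_
  have hq0 : q ≠ 0 := Finset.ne_of_mem_erase hq
  have hXpos : 0 < ‖Xs n M (n : ℂ) q‖ := norm_pos_iff.mpr (Xs_ne_zero n M (n : ℂ) hc hq0)
  have hX := norm_Xs_le n M hn hq0
  have hB0 : 0 ≤ ‖Bs n M (n : ℂ) b q‖ ^ 2 / ‖Xs n M (n : ℂ) q‖ ^ 2 := by positivity
  calc ‖Bs n M (n : ℂ) b q‖ ^ 2 / ‖Xs n M (n : ℂ) q‖
      = (‖Bs n M (n : ℂ) b q‖ ^ 2 / ‖Xs n M (n : ℂ) q‖ ^ 2) * ‖Xs n M (n : ℂ) q‖ := by field_simp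
    _ ≤ (‖Bs n M (n : ℂ) b q‖ ^ 2 / ‖Xs n M (n : ℂ) q‖ ^ 2)
          * ((d * Real.pi ^ 2 + (Real.pi ^ 2 / 4) ^ d * (d * Real.pi ^ 2) ^ 3 / 16) * ∑ k : Fin d → Fin n, ‖uSym n k (sOf M q)‖ ^ 2 / ‖lsym (fine n M) (n : ℂ) (pOf n M (k, q))‖ ^ 3) :=
        mul_le_mul_of_nonneg_left hX hB0
    _ = (d * Real.pi ^ 2 + (Real.pi ^ 2 / 4) ^ d * (d * Real.pi ^ 2) ^ 3 / 16) * ((‖Bs n M (n : ℂ) b q‖ ^ 2 / ‖Xs n M (n : ℂ) q‖ ^ 2)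
          * ∑ k : Fin d → Fin n, ‖uSym n k (sOf M q)‖ ^ 2 / ‖lsym (fine n M) (n : ℂ) (pOf n M (k, q))‖ ^ 3) := by ring

/-! ## §4 Position-space readings: the `H^{−1}` form, the slice as the range of `P`, and the divergence of a vector field -/

/-- Plancherel for pairings: `⟨f, g⟩ = ⟨f̃, g̃⟩` for the unitary DFT. [folklore] -/
theorem star_dotProduct_dft (f g : Tor (fine n M) → ℂ) :
    star (dft (fine n M) *ᵥ f) ⬝ᵥ (dft (fine n M) *ᵥ g) = star f ⬝ᵥ g := by
  have hU : star (dft (fine n M)) * dft (fine n M) = 1 :=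
    Matrix.mem_unitaryGroup_iff'.mp (dft_mem_unitaryGroup (fine n M))
  rw [Matrix.star_mulVec, ← Matrix.dotProduct_mulVec, Matrix.mulVec_mulVec, ← Matrix.star_eq_conjTranspose, hU, Matrix.one_mulVec]

/-- **THE `H^{−1}` FORM IN POSITION SPACE**: `Σ_p |f̃(p)|²∕Δ(p) = re⟨f, Δ⁻¹f⟩` (`Δ⁻¹ = LapSinv`, «putting its value on constant functions equal to 0» — both sides drop the zero mode,
Lean's `x ∕ 0 = 0` matching `linv 0 = 0`). [cite: Balaban1984PropagatorsI, Sect. C p.22] -/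
theorem sum_norm_sq_div_lsym_eq (c : ℂ) (f : Tor (fine n M) → ℂ) :
    ∑ p, ‖(dft (fine n M) *ᵥ f) p‖ ^ 2 / ‖lsym (fine n M) c p‖ = (star f ⬝ᵥ (LapSinv (fine n M) c *ᵥ f)).re := by
  rw [← star_dotProduct_dft n M f (LapSinv (fine n M) c *ᵥ f)]
  simp only [dotProduct, Pi.star_apply, dft_LapSinv_apply, Complex.re_sum]
  refine Finset.sum_congr rfl fun p _ => ?_
  set r : ℝ := ∑ ν, ‖ssym (fine n M) c ν p‖ ^ 2 with hrdef
  have hr : lsym (fine n M) c p = ((r : ℝ) : ℂ) := lsym_eq_sum_norm_sq (fine n M) c p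
  have hnorm : ‖lsym (fine n M) c p‖ = r := norm_lsym n M c p
  rw [hnorm, hr]
  set z : ℂ := (dft (fine n M) *ᵥ f) p
  have hz : star z * z = ((‖z‖ ^ 2 : ℝ) : ℂ) := by rw [Complex.star_def, Complex.conj_mul', Complex.ofReal_pow]
  calc ‖z‖ ^ 2 / r = (((‖z‖ ^ 2 / r : ℝ) : ℂ)).re := by rw [Complex.ofReal_re]
    _ = (star z * (((r : ℝ) : ℂ)⁻¹ * z)).re := by
        congr 1
        rw [← mul_assoc, mul_comm (star z), mul_assoc, hz, ← Complex.ofReal_inv, ← Complex.ofReal_mul]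
        congr 1
        rw [div_eq_inv_mul]

/-- **THE SLICE IS THE RANGE OF `P`**: if `b ⊥ 1` and `Δb = Q′*μ` for some multiplier `μ` on the unit lattice (print's (1.38) «`R D^*A = 0`» ⟺ «`Δ D^*A ∈ range Q′*`»,
✓ `B8Eq138Multiplier`∕`B8Eq138LandauZd` reading, at `U₀ = 1`), then `P b = b`.  The constant part of `μ` is invisible (`Q′*1` is constant, `Δ⁻¹` kills constants).
[cite: Balaban1984PropagatorsI, (1.26) p.22, (1.70) p.30; Balaban1985RegularSpaces, (1.38) p.82] -/
theorem PcT_mulVec_eq_self_of_slice {c : ℂ} (hc : c ≠ 0) (b : Tor (fine n M) → ℂ) (hb : ∑ x, b x = 0)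
    (μ : Tor M → ℂ) (hμ : LapS (fine n M) c *ᵥ b = (QsOp n M)ᴴ *ᵥ μ) : PcT n M c *ᵥ b = b := by
  -- normalise the multiplier to mean zero
  set a : ℂ := (∑ y, μ y) / Fintype.card (Tor M) with ha
  set μ₀ : Tor M → ℂ := fun y => μ y - a with hμ₀
  have hcard : (Fintype.card (Tor M) : ℂ) ≠ 0 := Nat.cast_ne_zero.mpr Fintype.card_ne_zero
  have hμ₀sum : ∑ y, μ₀ y = 0 := by
    simp only [hμ₀, Finset.sum_sub_distrib, Finset.sum_const, Finset.card_univ, nsmul_eq_mul, ha]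
    field_simp
    ring
  have hsplit : (QsOp n M)ᴴ *ᵥ μ = (QsOp n M)ᴴ *ᵥ μ₀ + fun _ => 1 / (n : ℂ) ^ d * a := by
    have e : μ = μ₀ + fun _ => a := by funext y; simp [hμ₀]
    conv_lhs => rw [e]
    rw [Matrix.mulVec_add]
    congr 1
    funext x
    rw [QsOp_adjoint_mulVec]
  -- `b = Δ⁻¹Δb = Δ⁻¹Q′*μ₀`
  have hbrepr : b = LapSinv (fine n M) c *ᵥ ((QsOp n M)ᴴ *ᵥ μ₀) := by
    have h := LapSinv_LapS_of_orth (fine n M) hc b hb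
    rw [hμ, hsplit, Matrix.mulVec_add, LapSinv_const, add_zero] at h
    exact h.symm
  -- `P(Δ⁻¹Q′*μ₀) = Δ⁻¹Q′*((Q′Δ⁻²Q′*)⁻¹(Q′Δ⁻²Q′*)μ₀) = Δ⁻¹Q′*μ₀`
  rw [hbrepr, PcT_mulVec]
  have hM : Minv n M c *ᵥ (QsOp n M *ᵥ (LapSinv (fine n M) c *ᵥ (LapSinv (fine n M) c *ᵥ ((QsOp n M)ᴴ *ᵥ μ₀)))) = μ₀ := by
    have h := Minv_Mop_of_orth n M c hc μ₀ hμ₀sum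
    rw [Mop_mulVec] at h
    exact h
  rw [hM]

/-- `‖v‖² = re⟨v, v⟩` for the dot-product pairing. [folklore] -/
theorem re_star_dotProduct_self {ι : Type*} [Fintype ι] (v : ι → ℂ) : (star v ⬝ᵥ v).re = ∑ i, ‖v i‖ ^ 2 := by
  simp only [dotProduct, Pi.star_apply, Complex.re_sum]
  refine Finset.sum_congr rfl fun i _ => ?_
  rw [Complex.star_def, Complex.conj_mul', ← Complex.ofReal_pow, Complex.ofReal_re]

/-- **`⟨∂^*A, Δ⁻¹∂^*A⟩ ≤ ‖A‖²`** — `∂Δ⁻¹∂^*` is the orthogonal projection onto the exact vector fields (`∂^*∂ = Δ`, `Δ⁻¹ΔΔ⁻¹ = Δ⁻¹`, `(Δ⁻¹)^* = Δ⁻¹`).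
[cite: Balaban1984PropagatorsI, (1.21) p.21, Sect. C p.22] -/
theorem re_dot_divS_LapSinv_le (c : ℂ) (A : Tor (fine n M) × Fin d → ℂ) :
    (star (divS (fine n M) c A) ⬝ᵥ (LapSinv (fine n M) c *ᵥ divS (fine n M) c A)).re ≤ ∑ i, ‖A i‖ ^ 2 := by
  set G : Matrix (Tor (fine n M) × Fin d) (Tor (fine n M)) ℂ := GradOp (fine n M) c with hG
  set Pe : Matrix (Tor (fine n M) × Fin d) (Tor (fine n M) × Fin d) ℂ := G * LapSinv (fine n M) c * Gᴴ with hPe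
  have hdiv : divS (fine n M) c A = Gᴴ *ᵥ A := (GradOp_conjTranspose_mulVec_eq (fine n M) c A).symm
  have hPeH : Peᴴ = Pe := by
    rw [hPe, Matrix.conjTranspose_mul, Matrix.conjTranspose_mul, Matrix.conjTranspose_conjTranspose, LapSinv_conjTranspose, Matrix.mul_assoc]
  have hPe2 : Pe * Pe = Pe := by
    have hmid : LapSinv (fine n M) c * LapS (fine n M) c * LapSinv (fine n M) c = LapSinv (fine n M) c := by
      rw [LapSinv_mul_LapS, Matrix.sub_mul, Matrix.one_mul, Pker_mul_LapSinv, sub_zero]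
    calc Pe * Pe = G * (LapSinv (fine n M) c * (Gᴴ * G) * LapSinv (fine n M) c) * Gᴴ := by
          rw [hPe]; simp only [Matrix.mul_assoc]
      _ = Pe := by rw [hG, GradOp_conjTranspose_mul_GradOp, ← hG, hmid, hPe]
  -- `⟨∂^*A, Δ⁻¹∂^*A⟩ = ⟨A, ΠA⟩ = ‖ΠA‖² (Π = ∂Δ⁻¹∂^*, named `Pe` below)`
  have hform : star (divS (fine n M) c A) ⬝ᵥ (LapSinv (fine n M) c *ᵥ divS (fine n M) c A) = star (Pe *ᵥ A) ⬝ᵥ (Pe *ᵥ A) := by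
    rw [form_of_projection Pe hPe2 hPeH A, hdiv, Matrix.star_mulVec, Matrix.conjTranspose_conjTranspose, ← Matrix.dotProduct_mulVec,
      Matrix.mulVec_mulVec, Matrix.mulVec_mulVec, hPe]
  -- `‖A‖² = ‖ΠA‖² + ‖(1 − Π)A‖²`
  have h1Pe2 : (1 - Pe) * (1 - Pe) = 1 - Pe := by
    rw [Matrix.sub_mul, Matrix.mul_sub, Matrix.mul_sub, Matrix.one_mul, Matrix.one_mul, Matrix.mul_one, hPe2, sub_self, sub_zero]
  have h1PeH : (1 - Pe)ᴴ = 1 - Pe := by rw [Matrix.conjTranspose_sub, Matrix.conjTranspose_one, hPeH]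
  have hpyth : star A ⬝ᵥ A = star (Pe *ᵥ A) ⬝ᵥ (Pe *ᵥ A) + star ((1 - Pe) *ᵥ A) ⬝ᵥ ((1 - Pe) *ᵥ A) := by
    rw [form_of_projection Pe hPe2 hPeH A, form_of_projection (1 - Pe) h1Pe2 h1PeH A, ← dotProduct_add, ← Matrix.add_mulVec, add_sub_cancel,
      Matrix.one_mulVec]
  have hre := congrArg Complex.re hpyth
  rw [Complex.add_re, re_star_dotProduct_self, re_star_dotProduct_self, re_star_dotProduct_self] at hre
  rw [hform, re_star_dotProduct_self]
  have hnn : 0 ≤ ∑ i, ‖((1 - Pe) *ᵥ A) i‖ ^ 2 := Finset.sum_nonneg fun i _ => sq_nonneg _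
  linarith

/-- ★★★ **LEMMA (S_blk-DIV), FLAT, DIVERGENCE FORM**: on the torus `T_η = Tor (fine n M)` (blocks of side `n ≥ 1`, lattice constant `c = n`), for every vector field `A` whose
divergence lies on print's (1.38) slice — `Δ(∂^*A) = Q′*μ` for some multiplier `μ` on the unit lattice (flat `IsLandau138`) —
`Σ_x |(∂^*A)(x)|² ≤ (dπ² + (π²∕4)^d(dπ²)³∕16)·Σ_{x,μ} |A(x,μ)|²`.  Here `∂^* = divS … n` carries the factor `c = n` ((1.1): `η⁻¹`-differences), so in LATTICE units this is
`‖div A‖² ≤ C_d·n⁻²·‖A‖²` — the SLICE row `DIV ≤ δ₀ℓ⁻²M` of ✓ `…LocMinOfGaugedRows116Text` at the flat background with `δ₀ = C_d`, `ζ = 0` (`ℓ = n = L^k`).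
[cite: Balaban1984PropagatorsI, (1.26) p.22, (1.35) p.24; Balaban1985RegularSpaces, (1.38) p.82; Balaban1985Variational, (21) p.281] -/
theorem sum_norm_sq_divS_le_of_slice (hn : 1 ≤ n) (A : Tor (fine n M) × Fin d → ℂ) (μ : Tor M → ℂ)
    (hslice : LapS (fine n M) (n : ℂ) *ᵥ divS (fine n M) (n : ℂ) A = (QsOp n M)ᴴ *ᵥ μ) :
    ∑ x, ‖divS (fine n M) (n : ℂ) A x‖ ^ 2 ≤ (d * Real.pi ^ 2 + (Real.pi ^ 2 / 4) ^ d * (d * Real.pi ^ 2) ^ 3 / 16) * ∑ i, ‖A i‖ ^ 2 := by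
  have hc : (n : ℂ) ≠ 0 := Nat.cast_ne_zero.mpr (NeZero.ne n)
  have hC0 : 0 ≤ (d * Real.pi ^ 2 + (Real.pi ^ 2 / 4) ^ d * (d * Real.pi ^ 2) ^ 3 / 16) := by positivity
  have hb : ∑ x, divS (fine n M) (n : ℂ) A x = 0 := sum_divS (fine n M) (n : ℂ) A
  have hP : PcT n M (n : ℂ) *ᵥ divS (fine n M) (n : ℂ) A = divS (fine n M) (n : ℂ) A :=
    PcT_mulVec_eq_self_of_slice n M hc _ hb μ hslice
  have h := sum_norm_sq_PcT_le n M hn (divS (fine n M) (n : ℂ) A) hb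
  rw [hP, sum_norm_sq_div_lsym_eq] at h
  exact h.trans (mul_le_mul_of_nonneg_left (re_dot_divS_LapSinv_le n M (n : ℂ) A) hC0)

end Summit.QuantumFields.YangMills.Theorems.Prop7BlockLandauDivFlat
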